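import Summits.Ventures.Crystal3D.Theorems.StickyWulffConstantTextureBuildContactEngine
import Summits.Ventures.Crystal3D.Theorems.StickyWulffConstantTextureBuildContactClasses
import Summits.Ventures.Crystal3D.Theorems.StickyWulffConstantTextureBuildFrameAgreement
import Summits.Ventures.Crystal3D.Theorems.StickyWulffConstantTextureBuildLawWeights
import HarnessLib

/-!
# TB-energy blueprint, the ROWS of the contact classification (L-P2) for non-box pairs, and their assembly `lp2_nonbox`
# (lane T, crux `TextureLiminfV5`, stmt-Ventures-23912; TB-D-3-g20 §LP2 rows (TT=) (TT≠) (TP) (PP) (QX) + addendum)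

HONEST FRAMING. Venture `Summits/Ventures/Crystal3D` (cell `crystal3d-full`), route `route-Ventures-StickyWulffConstant`, helper `--supports` the
law-v5 crux `TextureLiminfV5` (stmt-Ventures-23912).  Bookkeeping over the labelled cells of a texture input (standard axioms; no mesh constructed; F-C1 not moved).

WHAT.  At a GENERIC contact point `y` outside the designated regions, for pieces `i, i'` of different classes (engine …ContactEngine, classes …ContactClasses):
* (TT=) `lawW_eq_zero_of_grain_eq` — same grain, different slabs: `y` is on a layer plane, `p.1 = ± L e₃` is a shared axis ⇒ FREE;
* AGREEMENT `lawW_eq_zero_of_agreement` — stackings equal on a ball around the contact + frame witness ⇒ FREE (…FrameAgreement);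
* (TT≠) `lawW_eq_zero_of_territory_territory` — two territory pieces of different grains: `hagreeFr` ⇒ agreement ⇒ FREE;
* (TP)/(PT) `grain_eq_of_territory_prism` — a territory piece touching a prism piece has its grain (`hside₀/₁/₂` + the cut side): not a cross-grain contact;
* (PP) `cut_of_prism_prism` — two prism pieces of one cell with different grains touch across the CUT plane (special);
* (P×) `grain_eq_of_prism_not_prism` — a prism piece against anything outside its prism along a non-lateral facet: wrapped (`hPlat`, `hwrap₁/₂`) by
  its own grain's territory ⇒ same grain; lateral facets are designated;
* (Q×) `gap_row` — a gap piece against anything outside it along a non-designated facet (`hQmatch₅`): same grain, or an AGREEMENT datum, or the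
  other piece is a riser-BOX cell of a column grain carrying the label (the riser package's row, B6);
* **`lp2_nonbox`** — (L-P2) of the blueprint for every pair of NON-BOX pieces: cut-special ∨ free ∨ (contact ∖ designated) null.
Box rows (a riser-box cell on either side) wait for the riser package's claim rule (TB-D-3 addendum «hclaimMatch», B6).
-/

noncomputable section

open scoped BigOperators InnerProductSpace ENNReal
open MeasureTheory Set

namespace Summit.Ventures.Crystal3D.Cruxes.TextureLiminf.TexShadow

open Summit.Ventures.Crystal3D Summit.Ventures.Crystal3D.Theorems

/-- Agreement data are symmetric in the two grains. -/
theorem agreement_symm {C R₀ : ℝ} {N : ℕ} {x : Fin N → E3} (rc : RiseredCover C R₀ N x) {f g : Fin rc.ng} {z : E3} {ρ : ℝ}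
    (hS : rc.S f ∩ Metric.ball z ρ = rc.S g ∩ Metric.ball z ρ)
    (hFr : ((rc.tent f).L e₃ = (rc.tent g).L e₃ ∨ (rc.tent f).L e₃ = -((rc.tent g).L e₃)) ∨
      ∃ (A : E3 ≃ₗᵢ[ℝ] E3) (u : E3), rc.S f ∩ Metric.ball z ρ ⊆ (fun q => A q + u) '' fccRef) :
    ((rc.tent g).L e₃ = (rc.tent f).L e₃ ∨ (rc.tent g).L e₃ = -((rc.tent f).L e₃)) ∨
      ∃ (A : E3 ≃ₗᵢ[ℝ] E3) (u : E3), rc.S g ∩ Metric.ball z ρ ⊆ (fun q => A q + u) '' fccRef := by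
  rcases hFr with (h | h) | ⟨A, u, hA⟩
  · exact Or.inl (Or.inl h.symm)
  · exact Or.inl (Or.inr (by rw [h, neg_neg]))
  · exact Or.inr ⟨A, u, by rw [← hS]; exact hA⟩

namespace Mesh₅

variable {C R₀ : ℝ} {N : ℕ} {x : Fin N → E3} {rc : RiseredCover C R₀ N x} {δ : ℝ} (μ : Mesh₅ rc δ)

/-- The designated regions of a contact do not depend on the orientation of the datum. -/
theorem desOf₂_antip (p : E3 × ℝ) : μ.desOf₂ (antip p) = μ.desOf₂ p := by
  have key : ∀ q : E3 × ℝ, ((q.1, q.2) = antip p ∨ (-q.1, -q.2) = antip p) ↔ ((q.1, q.2) = p ∨ (-q.1, -q.2) = p) := by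
    intro q
    have e1 : (q.1, q.2) = q := rfl
    have e2 : (-q.1, -q.2) = antip q := rfl
    rw [e1, e2]
    constructor
    · rintro (h | h)
      · right; rw [h, antip_antip]
      · left; rw [← antip_antip q, h, antip_antip]
    · rintro (h | h)
      · right; rw [h]
      · left; rw [← antip_antip q, h]
  unfold desOf₂
  rw [Finset.filter_congr (fun d _ => key d.2)]

end Mesh₅

namespace TexInput

variable {C R₀ : ℝ} {N : ℕ} {x : Fin N → E3} {rc : RiseredCover C R₀ N x} {δ : ℝ} {μ : Mesh₅ rc δ} (I : TexInput rc μ)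

/-! ### Free contacts: equal lattices, or a shared axis across a layer plane -/

/-- Equal class lattices: the weight vanishes in every direction. -/
theorem lawW_eq_zero_of_lattice_eq {i i' : Fin I.cells.M}
    (h : (rc.tent (I.grain i)).frame (I.slab i) '' fccRef = (rc.tent (I.grain i')).frame (I.slab i') '' fccRef) (ν : E3) :
    lawW I.frameOf (I.cells.cls i) (I.cells.cls i') ν = 0 := by
  have h' : I.frameOf (I.cells.cls i) '' fccRef = I.frameOf (I.cells.cls i') '' fccRef := h
  unfold lawW
  rw [lawC_of_eq I.frameOf h', zero_div, zero_mul]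

/-- A shared axis `L e₃` of the class frames and a generic contact point on a boundary plane of the own slab: the weight vanishes across the facet. -/
theorem lawW_eq_zero_of_sharedAxis_slab {i i' : Fin I.cells.M} {p : E3 × ℝ} {y : E3} (hgen : I.Generic p y)
    (hax : SharedAxis ((rc.tent (I.grain i)).L e₃) ((rc.tent (I.grain i)).frame (I.slab i)) ((rc.tent (I.grain i')).frame (I.slab i')))
    {p₀ : E3 × ℝ} (hp₀ : p₀ ∈ laySlabH (rc.tent (I.grain i)).L (rc.tent (I.grain i)).s (I.slab i)) (hy₀ : ⟪p₀.1, y⟫_ℝ = p₀.2) :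
    lawW I.frameOf (I.cells.cls i) (I.cells.cls i') p.1 = 0 := by
  have hax' : SharedAxis ((rc.tent (I.grain i)).L e₃) (I.frameOf (I.cells.cls i)) (I.frameOf (I.cells.cls i')) := hax
  have h0 := lawW_eq_zero_of_sharedAxis I.frameOf hax'
  rcases I.fst_eq_or_of_generic hgen (I.laySlabH_slab_subset_𝓗 i hp₀) hy₀ with h | h <;>
    rcases fst_of_mem_laySlabH hp₀ with e | e
  · rw [h, e]; exact h0.1
  · rw [h, e]; exact h0.2
  · rw [h, e]; exact h0.2
  · rw [h, e, neg_neg]; exact h0.1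

/-- **AGREEMENT CONTACTS ARE FREE**: if the two grains' stackings coincide on a ball containing `closedBall y 2` and carry a frame witness there
(`hagreeFr` / `hmatchFr`), the weight vanishes across the facet at the generic contact point `y`. -/
theorem lawW_eq_zero_of_agreement {i i' : Fin I.cells.M} {p : E3 × ℝ} {y : E3} (hy : y ∈ I.contact i i' p) (hgen : I.Generic p y)
    {z : E3} {ρ : ℝ} (hB : Metric.closedBall y 2 ⊆ Metric.ball z ρ)
    (hS : rc.S (I.grain i) ∩ Metric.ball z ρ = rc.S (I.grain i') ∩ Metric.ball z ρ)
    (hFr : ((rc.tent (I.grain i)).L e₃ = (rc.tent (I.grain i')).L e₃ ∨ (rc.tent (I.grain i)).L e₃ = -((rc.tent (I.grain i')).L e₃)) ∨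
      ∃ (A : E3 ≃ₗᵢ[ℝ] E3) (u : E3), rc.S (I.grain i) ∩ Metric.ball z ρ ⊆ (fun q => A q + u) '' fccRef) :
    lawW I.frameOf (I.cells.cls i) (I.cells.cls i') p.1 = 0 := by
  have hya := closure_mono (I.subset_laySlab i) hy.1.1
  have hyb := closure_mono (I.subset_laySlab i') hy.2
  rcases (rc.tent (I.grain i)).frame_agreement (rc.tent (I.grain i')) hya hyb hB hS hFr with hlat | ⟨hax, p₀, hp₀, hy₀⟩
  · exact I.lawW_eq_zero_of_lattice_eq hlat p.1
  · exact I.lawW_eq_zero_of_sharedAxis_slab hgen hax hp₀ hy₀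

/-! ### Row (TT=): same grain -/

/-- **ROW (TT=)** — same grain, different classes: the contact is FREE (it lies on a layer plane of the common presentation). -/
theorem lawW_eq_zero_of_grain_eq {i i' : Fin I.cells.M} (hcls : I.cells.cls i' ≠ I.cells.cls i) (hg : I.grain i' = I.grain i)
    {p : E3 × ℝ} {y : E3} (hy : y ∈ I.contact i i' p) (hgen : I.Generic p y) :
    lawW I.frameOf (I.cells.cls i) (I.cells.cls i') p.1 = 0 := by
  have hs : I.slab i ≠ I.slab i' := fun h => hcls (I.cls_eq_of hg h.symm)
  have hya := closure_mono (I.subset_laySlab i) hy.1.1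
  have hyb := closure_mono (I.subset_laySlab i') hy.2
  rw [hg] at hyb
  obtain ⟨p₀, hp₀, hy₀⟩ := exists_laySlabH_of_mem_closure_closure _ _ hs hya hyb
  refine I.lawW_eq_zero_of_sharedAxis_slab hgen ?_ hp₀ hy₀
  rw [hg]
  exact (rc.tent (I.grain i)).sharedAxis_frame _ _

/-! ### Row (TT≠): two territory pieces of different grains -/

/-- **ROW (TT≠)** — two territory pieces of different grains: an agreement contact, FREE. -/
theorem lawW_eq_zero_of_territory_territory {i i' : Fin I.cells.M} (hg : I.grain i' ≠ I.grain i)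
    {f : Fin rc.ng} {jd : Fin (μ.nD f)} {g : Fin rc.ng} {jd' : Fin (μ.nD g)}
    (hi : polytope (I.cells.Hp i) ⊆ polytope (μ.HD f jd)) (hi' : polytope (I.cells.Hp i') ⊆ polytope (μ.HD g jd'))
    {p : E3 × ℝ} {y : E3} (hy : y ∈ I.contact i i' p) (hgen : I.Generic p y) :
    lawW I.frameOf (I.cells.cls i) (I.cells.cls i') p.1 = 0 := by
  have hf := I.grain_eq_of_piece_subset_HD hi
  have hg' := I.grain_eq_of_piece_subset_HD hi'
  have hfg : I.grain i ≠ I.grain i' := fun h => hg h.symm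
  have hyf : y ∈ closure (⋃ j, polytope (μ.HD (I.grain i) j)) := by
    rw [hf]; exact closure_mono (hi.trans (subset_iUnion (fun j => polytope (μ.HD f j)) jd)) hy.1.1
  have hyg : y ∈ closure (⋃ j, polytope (μ.HD (I.grain i') j)) := by
    rw [hg']; exact closure_mono (hi'.trans (subset_iUnion (fun j => polytope (μ.HD g j)) jd')) hy.2
  obtain ⟨r, hr, hS, hFr⟩ := μ.hagreeFr (I.grain i) (I.grain i') hfg y ⟨hyf, hyg⟩
  refine I.lawW_eq_zero_of_agreement hy hgen (z := y) (ρ := r + 4) (fun w hw => ?_) hS hFr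
  rw [Metric.mem_ball]
  linarith [Metric.mem_closedBall.1 hw]

/-! ### Rows (TP), (PT): a territory piece against a prism piece -/

/-- **ROW (TP)** — a territory piece touching a prism piece: the prism piece has the territory's grain (`hside₀/₁/₂` + the cut side). -/
theorem grain_eq_of_territory_prism {i i' : Fin I.cells.M} {f : Fin rc.ng} {jd : Fin (μ.nD f)}
    (hi : polytope (I.cells.Hp i) ⊆ polytope (μ.HD f jd)) {k : Fin rc.nk} (hi' : polytope (I.cells.Hp i') ⊆ polytope (μ.HP k))
    {p : E3 × ℝ} {y : E3} (hy : y ∈ I.contact i i' p) (hτ : I.τ k ∈ Set.Ioo (0 : ℝ) 1) (hR₀ : 1 ≤ R₀) :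
    I.grain i' = I.grain i := by
  have hf := I.grain_eq_of_piece_subset_HD hi
  have hyD : y ∈ closure (⋃ j, polytope (μ.HD f j)) := closure_mono (hi.trans (subset_iUnion (fun j => polytope (μ.HD f j)) jd)) hy.1.1
  have hyP : y ∈ closure (polytope (μ.HP k)) := closure_mono hi' hy.2
  have hgi' := I.grain_eq_of_piece_subset_HP hi'
  by_cases h1 : f = μ.fk k
  · subst h1
    have hh := μ.hside₁ k y ⟨hyD, hyP⟩
    have hlt : rc.height k y < I.τ k := by linarith [hτ.1]
    rw [hgi', if_pos (I.cutDatum_mem_T_of_contact_lt hy hlt), hf]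
  by_cases h2 : f = μ.gk k
  · subst h2
    have hh := μ.hside₂ k y ⟨hyD, hyP⟩
    have hgt : I.τ k < rc.height k y := by linarith [hτ.2, (rc.cell k).hh]
    rw [hgi', if_neg (I.cutDatum_not_mem_T_of_contact_gt hy hgt), hf]
  · exfalso
    exact Set.disjoint_left.1 (μ.hside₀ k f h1 h2) hyD hyP

/-- **ROW (PT)** — the same with the roles exchanged. -/
theorem grain_eq_of_prism_territory {i i' : Fin I.cells.M} {k : Fin rc.nk} (hi : polytope (I.cells.Hp i) ⊆ polytope (μ.HP k))
    {g : Fin rc.ng} {jd : Fin (μ.nD g)} (hi' : polytope (I.cells.Hp i') ⊆ polytope (μ.HD g jd))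
    {p : E3 × ℝ} {y : E3} (hy : y ∈ I.contact i i' p) (hτ : I.τ k ∈ Set.Ioo (0 : ℝ) 1) (hR₀ : 1 ≤ R₀) :
    I.grain i' = I.grain i :=
  (I.grain_eq_of_territory_prism hi' hi (I.contact_symm hy) hτ hR₀).symm

/-! ### Rows (PP), (P×): prism pieces -/

/-- **ROW (PP)** — two prism pieces of ONE cell with different grains touch across the cut plane. -/
theorem cut_of_prism_prism {i i' : Fin I.cells.M} (hne : i ≠ i') {k : Fin rc.nk} (hi : polytope (I.cells.Hp i) ⊆ polytope (μ.HP k))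
    (hi' : polytope (I.cells.Hp i') ⊆ polytope (μ.HP k)) (hg : I.grain i' ≠ I.grain i)
    {p : E3 × ℝ} (hp : p ∈ I.cells.Hp i) {y : E3} (hy : y ∈ I.contact i i' p) (hgen : I.Generic p y) :
    p = I.cutDatum k ∨ p = antip (I.cutDatum k) := by
  have h1 := I.grain_eq_of_piece_subset_HP hi
  have h2 := I.grain_eq_of_piece_subset_HP hi'
  have hs := I.signs_of_contact hne hp hy hgen (I.cutDatum k) (I.cutDatum_mem_𝓗 k)
  by_contra hq
  have hq' : ¬ (I.cutDatum k = p ∨ I.cutDatum k = antip p) := by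
    rintro (h | h)
    · exact hq (Or.inl h.symm)
    · exact hq (Or.inr (by rw [h, antip_antip]))
  rw [mem_flipT_of_ne (I.cutDatum_mem_𝓗 k) hq'] at hs
  apply hg
  rw [h1, h2]
  by_cases hc : I.cutDatum k ∈ I.cells.T (I.cells.idx i)
  · rw [if_pos hc, if_pos (hs.2 hc)]
  · rw [if_neg hc, if_neg (fun h => hc (hs.1 h))]

/-- **ROW (P×)** — a prism piece against a piece outside its prism, at a non-designated contact: same grain (lateral facets are designated; the other
facets are wrapped by the cut side's grain). -/
theorem grain_eq_of_prism_not_prism {i i' : Fin I.cells.M} (hne : i ≠ i') {k : Fin rc.nk} (hi : polytope (I.cells.Hp i) ⊆ polytope (μ.HP k))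
    (hi' : ¬ polytope (I.cells.Hp i') ⊆ polytope (μ.HP k)) {p : E3 × ℝ} (hp : p ∈ I.cells.Hp i) {y : E3} (hy : y ∈ I.contact i i' p)
    (hgen : I.Generic p y) (hnd : y ∉ μ.desOf₂ p) (hτ : I.τ k ∈ Set.Ioo (0 : ℝ) 1) (hR₀ : 1 ≤ R₀) :
    I.grain i' = I.grain i := by
  have hpk : p ∈ μ.HP k := I.mem_of_contact_of_subset hne hp hy hgen (I.HP_subset_𝓗 k) hi hi'
  have hyF : y ∈ facetOf (μ.HP k) p := I.mem_facetOf_of_contact hy hi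
  have hlat : p ∉ μ.latP k := fun hl => hnd (μ.mem_desOf₂ (μ.mem_desSet_P hl) (Or.inl rfl) hyF)
  have hgi := I.grain_eq_of_piece_subset_HP hi
  have hy' := I.contact_symm hy
  have hzP : ∀ {z : E3}, z ∈ polytope (I.cells.Hp i') → z ∉ closure (polytope (μ.HP k)) := fun hz h =>
    Set.disjoint_left.1 (I.disjoint_closure_of_not_subset (I.HP_subset_𝓗 k) hi') hz h
  rcases μ.hPlat k p (Finset.mem_sdiff.2 ⟨hpk, hlat⟩) y hyF with hlow | hhigh
  · obtain ⟨r, hr, hball⟩ := μ.hwrap₁ k y hyF.1 hlow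
    obtain ⟨z, hz, hzd⟩ := I.exists_mem_near_of_contact hy hr
    rcases hball (Metric.mem_ball.2 hzd) with h | h
    · exact absurd h (hzP hz)
    · obtain ⟨jd, hjd⟩ := I.exists_subset_HD_of_mem_closure hz h.1
      have hlt : rc.height k y < I.τ k := by linarith [hτ.1]
      rw [I.grain_eq_of_piece_subset_HD hjd, hgi, if_pos (I.cutDatum_mem_T_of_contact_lt hy' hlt)]
  · obtain ⟨r, hr, hball⟩ := μ.hwrap₂ k y hyF.1 hhigh
    obtain ⟨z, hz, hzd⟩ := I.exists_mem_near_of_contact hy hr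
    rcases hball (Metric.mem_ball.2 hzd) with h | h
    · exact absurd h (hzP hz)
    · obtain ⟨jd, hjd⟩ := I.exists_subset_HD_of_mem_closure hz h.1
      have hgt : I.τ k < rc.height k y := by linarith [hτ.2, (rc.cell k).hh]
      rw [I.grain_eq_of_piece_subset_HD hjd, hgi, if_neg (I.cutDatum_not_mem_T_of_contact_gt hy' hgt)]

/-- **ROW (×P)** — the same with the roles exchanged. -/
theorem grain_eq_of_not_prism_prism {i i' : Fin I.cells.M} (hne : i ≠ i') {k : Fin rc.nk} (hi : ¬ polytope (I.cells.Hp i) ⊆ polytope (μ.HP k))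
    (hi' : polytope (I.cells.Hp i') ⊆ polytope (μ.HP k)) {p : E3 × ℝ} (hp : p ∈ I.cells.Hp i) {y : E3} (hy : y ∈ I.contact i i' p)
    (hgen : I.Generic p y) (hnd : y ∉ μ.desOf₂ p) (hτ : I.τ k ∈ Set.Ioo (0 : ℝ) 1) (hR₀ : 1 ≤ R₀) :
    I.grain i' = I.grain i :=
  (I.grain_eq_of_prism_not_prism hne.symm hi' hi (I.antip_mem_Hp_of_contact hne hp hy hgen) (I.contact_symm hy) (I.generic_antip hgen)
    (by rwa [μ.desOf₂_antip]) hτ hR₀).symm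

/-! ### Row (Q×): gap pieces -/

/-- **ROW (Q×)** — a gap piece against a piece outside it, at a non-designated contact (`hQmatch₅`): same grain, or AGREEMENT data around a point of
the other piece within `1` of the contact, or the other piece is a riser-box cell of a box carrying the label (the riser package's row). -/
theorem gap_row {i i' : Fin I.cells.M} (hne : i ≠ i') {l : Fin μ.nQ} (hi : polytope (I.cells.Hp i) ⊆ polytope (μ.HQ l))
    (hi' : ¬ polytope (I.cells.Hp i') ⊆ polytope (μ.HQ l)) {p : E3 × ℝ} (hp : p ∈ I.cells.Hp i) {y : E3} (hy : y ∈ I.contact i i' p)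
    (hgen : I.Generic p y) (hnd : y ∉ μ.desOf₂ p) (hτ : ∀ k, I.τ k ∈ Set.Ioo (0 : ℝ) 1) :
    I.grain i' = I.grain i ∨
      (∃ (z : E3) (ρ : ℝ), Metric.closedBall y 2 ⊆ Metric.ball z ρ ∧
        rc.S (I.grain i) ∩ Metric.ball z ρ = rc.S (I.grain i') ∩ Metric.ball z ρ ∧
        (((rc.tent (I.grain i)).L e₃ = (rc.tent (I.grain i')).L e₃ ∨ (rc.tent (I.grain i)).L e₃ = -((rc.tent (I.grain i')).L e₃)) ∨
          ∃ (A : E3 ≃ₗᵢ[ℝ] E3) (u : E3), rc.S (I.grain i) ∩ Metric.ball z ρ ⊆ (fun q => A q + u) '' fccRef)) ∨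
      ∃ r, polytope (I.cells.Hp i') ⊆ polytope (μ.HB r) ∧ (rc.rtL r = I.grain i ∨ rc.rtR r = I.grain i) := by
  have hgl : I.grain i = μ.lab l := I.grain_eq_of_piece_subset_HQ hi
  have hpl : p ∈ μ.HQ l := I.mem_of_contact_of_subset hne hp hy hgen (I.HQ_subset_𝓗 l) hi hi'
  have hyF : y ∈ facetOf (μ.HQ l) p := I.mem_facetOf_of_contact hy hi
  have hdes : p ∉ μ.desQ l := fun hd => hnd (μ.mem_desOf₂ (μ.mem_desSet_Q hd) (Or.inl rfl) hyF)
  obtain ⟨r, hr, hball⟩ := μ.hQmatch₅ l p (Finset.mem_sdiff.2 ⟨hpl, hdes⟩) y hyF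
  obtain ⟨z, hz, hzd⟩ := I.exists_mem_near_of_contact hy (lt_min hr one_pos)
  have hzr : z ∈ Metric.ball y r := Metric.mem_ball.2 (lt_of_lt_of_le hzd (min_le_left _ _))
  have hz1 : dist z y < 1 := lt_of_lt_of_le hzd (min_le_right _ _)
  have hzQ : z ∉ closure (polytope (μ.HQ l)) := fun h =>
    Set.disjoint_left.1 (I.disjoint_closure_of_not_subset (I.HQ_subset_𝓗 l) hi') hz h
  rcases hball hzr with h | (((((h | h) | h) | h) | h) | h)
  · exact absurd h hzQ
  · -- own territory
    obtain ⟨jd, hjd⟩ := I.exists_subset_HD_of_mem_closure hz h.1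
    exact Or.inl (by rw [I.grain_eq_of_piece_subset_HD hjd, hgl])
  · -- deep bottom of a prism of a cell with `fk = lab l`
    obtain ⟨k, hk, hzk⟩ := mem_iUnion₂.1 h
    have hfk : μ.fk k = μ.lab l := (Finset.mem_filter.1 hk).2
    have hsub := I.subset_of_mem_closure (I.HP_subset_𝓗 k) hz hzk.1
    have hlt : rc.height k z < I.τ k := by
      have h2 : rc.height k z ≤ -1 := hzk.2
      linarith [(hτ k).1]
    refine Or.inl ?_
    rw [I.grain_eq_of_piece_subset_HP hsub, if_pos (I.cutDatum_mem_T_of_height_lt hz hlt), hfk, hgl]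
  · -- deep top of a prism of a cell with `gk = lab l`
    obtain ⟨k, hk, hzk⟩ := mem_iUnion₂.1 h
    have hgk : μ.gk k = μ.lab l := (Finset.mem_filter.1 hk).2
    have hsub := I.subset_of_mem_closure (I.HP_subset_𝓗 k) hz hzk.1
    have hgt : I.τ k < rc.height k z := by
      have h2 : (rc.cell k).h + 1 ≤ rc.height k z := hzk.2
      linarith [(hτ k).2, (rc.cell k).hh]
    refine Or.inl ?_
    rw [I.grain_eq_of_piece_subset_HP hsub, if_neg (I.cutDatum_not_mem_T_of_lt_height hz hgt), hgk, hgl]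
  · -- another gap piece of the same label
    obtain ⟨l', hl', hzl⟩ := mem_iUnion₂.1 h
    have hll : μ.lab l' = μ.lab l := (Finset.mem_filter.1 hl').2
    have hsub := I.subset_of_mem_closure (I.HQ_subset_𝓗 l') hz hzl
    exact Or.inl (by rw [I.grain_eq_of_piece_subset_HQ hsub, hll, hgl])
  · -- a riser box of a column grain carrying the label (riser package row)
    obtain ⟨r', hr', hzr'⟩ := mem_iUnion₂.1 h
    have hsub := I.subset_of_mem_closure (I.HB_subset_𝓗 r') hz hzr'
    refine Or.inr (Or.inr ⟨r', hsub, ?_⟩)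
    rw [hgl]
    exact (Finset.mem_filter.1 hr').2
  · -- AGREEMENT with another grain
    obtain ⟨g, hg, hzg⟩ := mem_iUnion₂.1 h
    obtain ⟨hzD, -, r', hr', hS⟩ := hzg
    obtain ⟨jd, hjd⟩ := I.exists_subset_HD_of_mem_closure hz hzD
    have hgi' : I.grain i' = g := I.grain_eq_of_piece_subset_HD hjd
    have hgne : g ≠ μ.lab l := (Finset.mem_filter.1 hg).2
    have hFr := μ.hmatchFr (μ.lab l) g (Ne.symm hgne) z hzD r' hr' hS
    refine Or.inr (Or.inl ⟨z, r' + 4, fun w hw => ?_, ?_, ?_⟩)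
    · rw [Metric.mem_ball]
      calc dist w z ≤ dist w y + dist y z := dist_triangle _ _ _
        _ < r' + 4 := by rw [dist_comm y z]; linarith [Metric.mem_closedBall.1 hw]
    · rw [hgl, hgi']; exact hS
    · rw [hgl, hgi']; exact hFr

/-! ### (L-P2) for non-box pairs -/

/-- **(L-P2) OF THE BLUEPRINT FOR EVERY PAIR OF NON-BOX PIECES**: a cross-class contact of two pieces outside the riser boxes is a CUT special, or
free, or a.e. inside the designated regions (the `hP2` row of `wall_le_split`, box pairs excepted). -/
theorem lp2_nonbox (hτ : ∀ k, I.τ k ∈ Set.Ioo (0 : ℝ) 1) (hR₀ : 1 ≤ R₀) {i i' : Fin I.cells.M} (hcls : I.cells.cls i' ≠ I.cells.cls i)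
    (hbi : ∀ r, ¬ polytope (I.cells.Hp i) ⊆ polytope (μ.HB r)) (hbi' : ∀ r, ¬ polytope (I.cells.Hp i') ⊆ polytope (μ.HB r))
    {p : E3 × ℝ} (hp : p ∈ I.cells.Hp i) :
    (∃ k, polytope (I.cells.Hp i) ⊆ polytope (μ.HP k) ∧ polytope (I.cells.Hp i') ⊆ polytope (μ.HP k) ∧
        (p = I.cutDatum k ∨ p = antip (I.cutDatum k))) ∨
      lawW I.frameOf (I.cells.cls i) (I.cells.cls i') p.1 = 0 ∨ facetArea (I.contact i i' p \ μ.desOf₂ p) p.1 = 0 := by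
  have hne := I.ne_of_cls_ne hcls
  rw [← or_assoc]
  refine I.classify_of_point hp fun y hy hgen hnd => ?_
  -- same grain: free
  by_cases hg : I.grain i' = I.grain i
  · exact Or.inr (I.lawW_eq_zero_of_grain_eq hcls hg hy hgen)
  rcases I.piece_cases i with ⟨f, jd, hi⟩ | ⟨k, hi⟩ | ⟨l, hi⟩ | ⟨r, hi⟩
  · -- `i` is a territory piece
    rcases I.piece_cases i' with ⟨g, jd', hi'⟩ | ⟨k', hi'⟩ | ⟨l', hi'⟩ | ⟨r', hi'⟩
    · exact Or.inr (I.lawW_eq_zero_of_territory_territory hg hi hi' hy hgen)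
    · exact absurd (I.grain_eq_of_territory_prism hi hi' hy (hτ k') hR₀) hg
    · have hiQ : ¬ polytope (I.cells.Hp i) ⊆ polytope (μ.HQ l') := fun h =>
        Set.disjoint_left.1 (μ.hQD l' f) (h (I.cells.hne _).some_mem) (mem_iUnion.2 ⟨jd, hi (I.cells.hne _).some_mem⟩)
      rcases I.gap_row hne.symm hi' hiQ (I.antip_mem_Hp_of_contact hne hp hy hgen) (I.contact_symm hy) (I.generic_antip hgen)
          (by rwa [μ.desOf₂_antip]) hτ with h | ⟨z, ρ, hB, hS, hFr⟩ | ⟨r, hr, -⟩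
      · exact absurd h.symm hg
      · exact Or.inr (I.lawW_eq_zero_of_agreement hy hgen hB hS.symm (agreement_symm rc hS hFr))
      · exact absurd hr (hbi r)
    · exact absurd hi' (hbi' r')
  · -- `i` is a prism piece
    by_cases hk' : polytope (I.cells.Hp i') ⊆ polytope (μ.HP k)
    · exact Or.inl ⟨k, hi, hk', I.cut_of_prism_prism hne hi hk' hg hp hy hgen⟩
    · exact absurd (I.grain_eq_of_prism_not_prism hne hi hk' hp hy hgen hnd (hτ k) hR₀) hg
  · -- `i` is a gap piece
    by_cases hl' : polytope (I.cells.Hp i') ⊆ polytope (μ.HQ l)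
    · exact absurd (by rw [I.grain_eq_of_piece_subset_HQ hi, I.grain_eq_of_piece_subset_HQ hl']) hg
    · rcases I.gap_row hne hi hl' hp hy hgen hnd hτ with h | ⟨z, ρ, hB, hS, hFr⟩ | ⟨r, hr, -⟩
      · exact absurd h hg
      · exact Or.inr (I.lawW_eq_zero_of_agreement hy hgen hB hS hFr)
      · exact absurd hr (hbi' r)
  · exact absurd hi (hbi r)

end TexInput

end Summit.Ventures.Crystal3D.Cruxes.TextureLiminf.TexShadow

end
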